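import Mathlib
import HarnessLib
import HarnessLib.Audit
import Summits.Langlands.Statement
import Literature.NumberTheory.GaloisRepresentations.HeckeCharacter

/-!
Route: CriticalCocycle

CLOSED (retired) 2026-08-15T13:48:39Z by operator:999:1257524 — reason: not-a-thesis: assembly does not conclude the sub-problem Statement — note: D-0027 §2.1 audit (human 2026-08-15: routes that do not decide the summit are removed): the assembly concludes `PotentialAutomorphyDescends`, not the sub-problem statement; a NEW conforming route may be opened from the same idea (generated `closes : … → _root_.Langlands`).. The file is kept as the record of this route; refuted decls are indexed as negative knowledge (`ledger negatives`).

THESIS X (card Langlands/Langlands/cohomological-converse-critical-cocycle, "critical values form a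
cocycle"). It suffices to show
X := CohomologicalConverse ∧ JointPotentialAutomorphy ∧ CocycleIdentity (the three crux decls of
this file), for the TARGET
PotentialAutomorphyDescends = direction (B) over ℚ in the regular (Hodge–Tate gaps ≥ 2),
potentially-automorphic sector at the
Satake level: for n ≥ 2 every irreducible ρ : G_ℚ → GL_n(ℚ̄_ℓ) which over some finite Galois F/ℚ
corresponds (Satake–Frobenius a.e.,
HLTT normalisation `arithFrobPolyOfSatake ι q n α`) to a cuspidal regular-algebraic Π of GL_n(𝔸_F)
corresponds over ℚ to a cuspidal
regular-algebraic π of GL_n(𝔸_ℚ) — i.e. automorphy DESCENDS along the insoluble extension F/ℚ that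
potential automorphy
(BarnetlambEtAl2014, PatrikisTaylor2014) leaves behind.
In words: (1) CohomologicalConverse — a Maass-free converse theorem that lives in Betti cohomology:
automorphy of a regular-algebraic
candidate over ℚ is decided by finitely many LINEAR relations among off-centre Rankin–Selberg values
against COHOMOLOGICAL cusp forms τ on
GL_m, m < n (typed as the existence of a finite critical-value presentation with Converse and
Necessity clauses; intended witness:
Kazhdan–Mazur–Schmidt relative modular symbols + their relation module); (2)
JointPotentialAutomorphy — ρ and each cohomological twist τ
become automorphic over a COMMON Galois F, so that by Brauer + Arthur–Clozel every off-centre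
critical value of Λ(ρ ⊗ ρ_τ) is an
unconditional number (absolutely convergent Euler product, boundary value, or FE-mirror); (3)
CocycleIdentity — these numbers satisfy the
relations ("Φ_ρ kills the relation module"; interim typed shadow, to be restated over the KMS
presentation once defined).
Lean (elaborates, folder Sketch.lean rc 0, 2026-08-15): `def Assembly : Prop :=
CohomologicalConverse → JointPotentialAutomorphy →
CocycleIdentity → PotentialAutomorphyDescends` over
Literature.NumberTheory.Automorphic.{CuspidalAutomorphicRepData, AutomorphicRepData,
HasSatakeParamAt, HasInfinityType, InfinityType, IsRegularAlgebraic, arithFrobPolyOfSatake,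
principalCongruenceLevel, rightTranslation,
isCompact_glFiniteIntegralLevel} and Literature.NumberTheory.GaloisRepresentations.{FramedGaloisRep,
restrictField, IsUnramifiedAt,
HasFrobCharpolyAt}; the assembly itself is elementary logic + finiteness of the exceptional set S +
isCompact_glFiniteIntegralLevel_holds.
Relation to the summit: PotentialAutomorphyDescends + potential automorphy (BLGGT Thm 4.5.1/5.4.1, a
named fact to be filed) + LGC for π
(direction (A): HLTT/VarmaFMS2024/Caraiani) give Summit.Langlands.GaloisToAutomorphic for F = ℚ, ρ
regular polarizable with HT gaps ≥ 2;
weight-2-type ρ (some HT gap = 1: elliptic curves, weight-0 cohomology) are OUTSIDE this route by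
design (no off-centre critical value),
n = 1 is class field theory (card rank-one-acid-test), other base fields: same shape with
Res_{F/ℚ}GL_n (not opened here).

Rationale: WHY THIS LINE. Every converse theorem needs analytic control of twists by ALL cusp forms on
GL_{n-2}/GL_{n-1}, including Maass forms
with no Galois avatar — this is what killed card descent-without-base-change (retired: refuted) and
caps analytic routes at n = 3
(Cogdell–PS, CogdellPiatetskishapiro1999; Booker2003; BookerKrishnamurthy2014IMRN). For REGULAR ρ
the receptacle is finite-dimensional:
H^{b_n}_cusp(Γ(N), V_λ), detected by algebraic cycles (Kazhdan–Mazur–Schmidt relative modular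
symbols, KazhdanMazurSchmidt2000) whose
periods are critical values of L(π × τ) for COHOMOLOGICAL τ only (Raghuram2009, Sun2016, critical
numbers Schmidt2017). Potential
automorphy (BarnetlambEtAl2014) + Brauer make every OFF-CENTRE critical value of the virtual Λ(ρ ⊗
ρ_τ) an unconditional number, so (B)
for regular ρ over ℚ becomes a finitely presented identity among numbers we already own; n = 2 is
Eichler–Shimura–Manin read backwards
(Razar1977, Kohnen–Zagier, PasolPopa2013, Merel1994). Imported areas: topology of arithmetic groups
(AshRudolph1979, sharbly complexes),
automorphic period integrals, potential automorphy. No trace formula, no deformation theory.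
RANKED CRUXES. #2 CohomologicalConverse (the new theorem-object; contains the card's S1
spanning-mod-Hecke and S2 relations; typed as
∃ finite critical-value presentation with Converse ∧ Necessity; anti-vacuity: finite probes,
canonical ordered Euler values incl. boundary
line, coefficients polynomial in finitely many unknown bad factors — a 'cheat' listing automorphic
value-vectors needs an unprovable
transcendence statement for Converse). #3 CocycleIdentity (where (B) lives; interim shadow logically
= (#2 → Target); RESTATE over
defn RelativeModularSymbolPresentation when it lands; attack in sectors: n = 2 calibration = known
GL_2 Fontaine–Mazur (Kisin2009, Pan2022);
CM-induced non-solvable ρ via Eisenstein–Kronecker cocycles = card engine S6; numerics). #4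
JointPotentialAutomorphy (BLGGT 5.4.1 for
polarizable pairs; non-self-dual GL_3/GL_4 twists need Qian2022/ACCGHLNSTT2023-type input).
SUPPORT (unranked): SolvableDescent (Target for solvable Gal(F/ℚ): Arthur–Clozel,
ArthurClozelAMS120; tree ArthurClozelCuspidalDescent*,
provable from named facts), CohomologicalConverseRankTwo (n = 2: provable now in principle; needs
weight-k modular symbols for Γ_1(N)),
NonNormalInduction (first open instances: automorphic induction of algebraic Hecke characters
through non-normal K/ℚ, template
Literature.NumberTheory.Automorphic.automorphicInduction_character; the card's degree-10 CM/A_5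
example lives here).
KILL CRITERIA. (i) A locally-genuine globally-virtual Brauer combination (S_3: std − 1 + sgn;
regular analogues by tensoring CM inductions)
is a degree-n Euler product whose cohomological twists are all meromorphic with FE and poles only in
the OPEN central strip, yet it is not
automorphic: if certified numerics show such a fake SATISFIES the level-N period relations (n = 2, k
= 4, small N), CohomologicalConverse is
dead. (ii) A cuspidal cohomological π on GL_4/ℚ all of whose off-centre GL_3-critical values against
cohomological τ vanish or fail to
separate it (Ash–Ginzburg-type degeneracy) refutes the intended witness of #2. (iii) #4 refuted for
a non-self-dual GL_3 twist ⇒ restrict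
probes to polarizable τ (restate), not fatal. (iv) CocycleIdentity numerically violated by a genuine
ρ_π ⇒ mis-normalisation, restate.
DELIBERATELY NOT DECOMPOSED: the KMS presentation itself (definition requests
RelativeModularSymbolPresentation, CuspidalCohomologyGL filed
with this route), archimedean period constants (Raghuram–Shahidi, Sun2016), Eisenstein probes beyond
products of cuspidal pieces, levels
needing Hecke-translate probes, other base fields, the weight-2 sector (central values; needs a
different idea), LGC upgrade to `Corresponds`.

Novelty: Nearest prior art (searched 2026-08-15: crossref 'relative modular symbols Rankin–Selberg' →
KazhdanMazurSchmidt2000 doi:10.1515/crll.2000.019,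
Schmidt 1993 doi:10.1007/bf01232425, Januszewski 2011 doi:10.1515/crelle.2011.018, Kasten–Schmidt
2012, Schmidt2017 doi:10.1016/j.jnt.2016.10.004 —
all automorphic→arithmetic (periods, p-adic L-functions), none a converse theorem; crossref
'determination of modular forms by twists of critical
L-values' → LuoRamakrishnan1997 doi:10.1007/s002220050189, Munshi 2009, Hamieh–Tanabe 2017 —
injectivity among GENUINE forms = our spanning
half only; crossref 'converse theorem Dirichlet series poles' → Raghunathan 1998
doi:10.1016/s0764-4442(98)80138-9, BookerKrishnamurthy2014IMRN
(finitely many poles only); Razar1977 doi:10.1007/bfb0065294 + Kohnen–Zagier + PasolPopa2013 +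
Merel1994 = the n = 2 case; potential automorphy
and its solvable descent: BarnetlambEtAl2014 doi:10.4007/annals.2014.179.2.3, PatrikisTaylor2014;
the card's own refuter audit (zbMATH
'converse theorem modular symbols', 'restricted twists') found no cohomological converse theorem for
GL_n. lit search --hybrid / galaxy were
unavailable in this session (daemon reset / queue timeout) — recorded in NOTES. DELTA: (i) a
converse theorem formulated inside Betti
cohomology so that only cohomological twists occur (removes the Maass obstruction that refuted
descent-without-base-change and caps analytic
converse theorems at rank 3); (ii) typed as 'finitely many linear relations among o  [refs: 10.1515/crll.2000.019, 10.1007/bf01232425, 10.1515/crelle.2011.018, 10.1016/j.jnt.2016.10.004, 10.1007/s002220050189, 10.1016/s0764-4442(98, 10.1007/bfb0065294, 10.4007/annals.2014.179.2.3, doi:10.1515/crll.2000.019, doi:10.1007/bf01232425, doi:10.1515/crelle.2011.018, doi:10.1016/j.jnt.2016.10.004, doi:10.1007/s002220050189, doi:10.1016/s0764-4442, doi:10.1007/bfb0065294, doi:10.4007/annals.2014.]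

Barriers (technique_class: converse-theorem betti-cohomology brauer-induction): Literature.Barriers.Langlands.SolvableImageBarrier: clause (b) (Brauer/potential automorphy give
meromorphy + FE, never automorphy) is accepted
verbatim — the Target is exactly the residual non-solvable descent; evasion = the extra input is
topological (linear relations among off-centre
values against algebraic cycles over ℚ), no base change along insoluble layers; SolvableDescent
(support) is the barrier's own positive side.
Literature.Barriers.Langlands.SolvableImageBarrierNarrow: same; the CM-induced degree-10/A_5
instances (NonNormalInduction) sit inside the
barrier's residual class on purpose.
Literature.Barriers.Langlands.NonRegularWeightBarrier: NOT evaded and not meant to be — the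
receptacle is Betti cohomology with algebraic
coefficients; moreover HT gaps ≥ 2 are required (no off-centre critical value in weight-2 type),
stated in every item.
Literature.Barriers.Langlands.ShimuraVarietyRealizationBarrier: irrelevant on the converse side
(locally symmetric spaces of GL_n/ℚ have Betti
cohomology); enters only through Galois representations of the twists τ (HLTT over ℚ) inside
JointPotentialAutomorphy.
Literature.Barriers.Langlands.TaylorWilesNumericalCoincidence, PatchingLocalComponentBarrier,
ResiduallyReducibleBarrier, ModPLanglandsGL2BeyondQp:
not engaged — no deformation theory; residual hypotheses live only inside the imported
potential-automorphy theorems (crux #4), for a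
density-one set of ℓ.
Literature.Barriers.Langlands.TwistedEndoscopySelfDual: touched only by

Novelty grade: new-combination — ROUTE REVIEW (refuter rreview g2, 2026-08-15). Novelty NOT re-searched (grade = card audits 1-4, new-combination). Route found CLOSED(retired) 13:48Z; closure right on TWO counts. (i) Conformance is substantive: Assembly concludes PotentialAutomorphyDescends ((B) over Q, regular pot.-automorphic sec (refuter refuter-rreview-route-AtomisticToContinu-8d156edd-g2-0, 2026-08-15T14:41:20Z; prior: KazhdanMazurSchmidt2000 doi:10.1515/crll.2000.019, CogdellPiatetskishapiro1999 doi:10.1515/crll.1999.507.165, Razar1977; Kohnen-Zagier 1984; PasolPopa2013; Merel1994 (n=2), BarnetlambEtAl2014 doi:10.4007/annals.2014.179.2.3; PatrikisTaylor2014, inherited from card audits 1-4)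

History (route lifecycle, newest last):
- 2026-08-15T13:48:39Z · CLOSED retired — not-a-thesis: assembly does not conclude the sub-problem Statement (operator:999:1257524)

sub-problem: Langlands · status: closed(retired) · opened planner-plancard-Langlands-Langlands-cohomolo-5eafa618-0 2026-08-15T11:23:10Z · rev 3 · ledger route-Langlands-CriticalCocycle
GENERATED by the gate from the ledger (D-0016/17). Provers cite these decls: `theorem foo : Summit.Langlands.Langlands.Theses.CriticalCocycle.<Decl> := …` in Summits/Langlands/Langlands/Theorems/<Name>.lean.
-/

namespace Summit.Langlands.Langlands.Theses.CriticalCocycle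

open scoped BigOperators Topology Manifold Classical MeasureTheory ProbabilityTheory Matrix InnerProductSpace ComplexConjugate ContinuousMap
open Filter Set Function TopologicalSpace MeasureTheory

attribute [summit_statement] _root_.Langlands

/-- item stmt-Langlands-3696 · target · rank 0 · closed · moot by None · by planner
why it might fail: Open insoluble descent: false iff an irreducible regular ρ (HT gaps ≥2) is cuspidal over an insoluble Galois F yet not over ℚ. FM+Langlands say never, but all tools stop at solvable Gal(F/ℚ) with TR/CM layers (AC descent pins the twist only via Galois reps), and F is typed arbitrary.
sources: BarnetlambEtAl2014, PatrikisTaylor2014, ArthurClozelAMS120, HarrisLanTaylorThorneRMS2016, FontaineMazurGeometric1995, Literature.Barriers.Langlands.SolvableImageBarrier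
[target] Direction (B) over ℚ in the regular potentially-automorphic sector, Satake level: for n ≥
2, every irreducible ρ : G_ℚ → GL_n(ℚ̄_ℓ) which over some finite Galois F/ℚ corresponds at almost
all places (HLTT normalisation arithFrobPolyOfSatake ι q n α, as in lang.S27) to a CUSPIDAL Π of
GL_n(𝔸_F) having a regular-algebraic infinity type W with Hodge–Tate gaps ≥ 2 at every embedding
(|Re(a_i − a_j)| ≥ 2; GL_2: weight k ≥ 3) already corresponds over ℚ to a cuspidal regular-algebraic
π of GL_n(𝔸_ℚ). Junk-free: no p-adic Hodge datum — 'geometric + regular' is replaced by its known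
consequence 'potentially automorphic' (BarnetlambEtAl2014 Thm 4.5.1/5.4.1, PatrikisTaylor2014), so
this IS the non-solvable descent left open by Literature.Barriers.Langlands.SolvableImageBarrier
(b). With potential automorphy (named fact to file) and local-global compatibility for π (direction
(A): HarrisLanTaylorThorneRMS2016, VarmaFMS2024) it yields Summit.Langlands.GaloisToAutomorphic for
F = ℚ, ρ regular polarizable with HT gaps ≥ 2. Outside by design: weight-2 type (some HT gap 1:
elliptic curves, weight-zero cohomology of GL_n), n = 1 (class field theory, card
rank-one-acid-test), other base fiel -/
@[route_item "route-Langlands-CriticalCocycle"]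
def PotentialAutomorphyDescends : Prop :=
  ∀ (n ℓ : ℕ) [Fact ℓ.Prime] (ι' : PadicAlgCl ℓ ≃+* ℂ) (hQ : Literature.NumberTheory.Automorphic.isCompact_glFiniteIntegralLevel n ℚ) (ρ : Literature.NumberTheory.GaloisRepresentations.FramedGaloisRep ℚ (PadicAlgCl ℓ) n), 2 ≤ n → ρ.toGaloisRep.IsIrreducible → (∃ (F : Type) (_ : Field F) (_ : NumberField F) (_ : IsGalois ℚ F) (hF : Literature.NumberTheory.Automorphic.isCompact_glFiniteIntegralLevel n F) (P : Literature.NumberTheory.Automorphic.CuspidalAutomorphicRepData n F hF) (W : Literature.NumberTheory.Automorphic.InfinityType F n), P.1.HasInfinityType W ∧ W.IsRegularAlgebraic ∧ (∀ (σ : F →+* ℂ) (p q : Literature.NumberTheory.Automorphic.ArchWeight), p ∈ W σ → q ∈ W σ → p ≠ q → (2 : ℝ) ≤ |(p.a - q.a).re|) ∧ ∀ᶠ w in cofinite, ∃ α, P.1.HasSatakeParamAt w α ∧ (ρ.restrictField F).IsUnramifiedAt w ∧ (ρ.restrictField F).HasFrobCharpolyAt w (Literature.NumberTheory.Automorphic.arithFrobPolyOfSatake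 ι' w.residueCard n α)) → ∃ π : Literature.NumberTheory.Automorphic.CuspidalAutomorphicRepData n ℚ hQ, π.1.IsRegularAlgebraic ∧ ∀ᶠ v in cofinite, ∃ α, π.1.HasSatakeParamAt v α ∧ ρ.IsUnramifiedAt v ∧ ρ.HasFrobCharpolyAt v (Literature.NumberTheory.Automorphic.arithFrobPolyOfSatake ι' v.residueCard n α)

/-- item stmt-Langlands-3697 · crux · rank 2 · closed · moot by None · by planner
why it might fail: FALSE as typed (kernel-checked mod ONE cusp form): pad a genuine Satake family (Δ) with an extra entry 0 at one v₀∉S — each factor (1−0·b·q^(−s))⁻¹=1 and 0⁻¹=0 if dual, so crit is unchanged; Converse then yields a Satake parameter of card n+1 at v₀, contradicting HasSatakeParamAt.card_eq.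
sources: KazhdanMazurSchmidt2000, JacquetShalikaAJM1981II, Razar1977, LuoRamakrishnan1997, Literature.NumberTheory.Automorphic.AutomorphicRepData.HasSatakeParamAt.card_eq, Literature.NumberTheory.Automorphic.Gelbart1975_exists_adelicNewform
[crux] COHOMOLOGICAL (MAASS-FREE) CONVERSE THEOREM, typed as the EXISTENCE OF A FINITE
CRITICAL-VALUE PRESENTATION. For n ≥ 2, level N ≥ 1 and a regular-algebraic infinity type w of
GL_n/ℚ with HT gaps ≥ 2 there are: finitely many PIECES k (a cuspidal regular-algebraic τ_k on
GL_{m_k}/ℚ, m_k < n, with Satake family β_k off a finite set S ⊇ primes(N); a point s_k; a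
contragredient flag), grouped into PROBES i by `own`; a set R of linear relations on probes with
coefficients polynomial in d unknowns x (standing for the finitely many bad Euler/ε-factors); such
that, for a candidate Satake family α off S, crit(α) := ∃ x z, z_k = lim_{X→∞} ∏_{v∉S, Nv≤X}
L_v(s_k, α^{(∨)} × β_k) (ordered Euler product: converges absolutely beyond, and conditionally ON,
the boundary of the critical strip — so every OFF-CENTRE critical point is reachable, the centre is
not) and Σ_i r_i(x)·∏_{own k = i} z_k = 0 for all r ∈ R, satisfies CONVERSE (crit α ⇒ α is, off S,
the Satake family of a cuspidal π of GL_n/ℚ with infinity type w) and NECESSITY (every cuspidal π of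
infinity type w with a K(N)-fixed vector satisfies crit). Products of pieces encode Eisenstein
classes of GL_{n-1} (L(π × (τ₁ ⊞ τ₂)) = L(π×τ₁)L( -/
@[route_item "route-Langlands-CriticalCocycle"]
def CohomologicalConverse : Prop :=
  ∀ (n N : ℕ), 2 ≤ n → 1 ≤ N → ∀ (hc : ∀ j : ℕ, Literature.NumberTheory.Automorphic.isCompact_glFiniteIntegralLevel j ℚ) (w : Literature.NumberTheory.Automorphic.InfinityType ℚ n), w.IsRegularAlgebraic → (∀ (σ : ℚ →+* ℂ) (p q : Literature.NumberTheory.Automorphic.ArchWeight), p ∈ w σ → q ∈ w σ → p ≠ q → (2 : ℝ) ≤ |(p.a - q.a).re|) → ∃ (ι κ : Type) (_ : Fintype ι) (_ : Fintype κ) (own : κ → ι) (m : κ → ℕ) (τ : ∀ k, Literature.NumberTheory.Automorphic.CuspidalAutomorphicRepData (m k) ℚ (hc (m k))) (β : κ → IsDedekindDomain.HeightOneSpectrum (NumberField.RingOfIntegers ℚ) → Multiset ℂ) (s : κ → ℂ) (dual : κ → Bool) (d : ℕ) (R : Set (ι → MvPolynomial (Fin d) ℂ)) (S : Finset (IsDedekindDomain.HeightOneSpectrum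 (NumberField.RingOfIntegers ℚ))), let crit : (IsDedekindDomain.HeightOneSpectrum (NumberField.RingOfIntegers ℚ) → Multiset ℂ) → Prop := fun α => ∃ (x : Fin d → ℂ) (z : κ → ℂ), (∀ k, Tendsto (fun X : ℕ => ∏ᶠ v ∈ {v : IsDedekindDomain.HeightOneSpectrum (NumberField.RingOfIntegers ℚ) | v ∉ S ∧ v.residueCard ≤ X}, ((if dual k then (α v).map (fun a => a⁻¹) else α v).bind fun a => (β k v).map fun b => (1 - a * b * (v.residueCard : ℂ) ^ (-(s k)))⁻¹).prod) atTop (𝓝 (z k))) ∧ ∀ r ∈ R, ∑ i, MvPolynomial.eval x (r i) * (∏ k ∈ Finset.univ.filter (fun k => own k = i), z k) = 0; (∀ k, m k < n ∧ (τ k).1.IsRegularAlgebraic ∧ ∀ v, (τ k).1.HasSatakeParamAt v (β k v) ∨ v ∈ S) ∧ (∀ v, v ∈ S ∨ ¬ v.asIdeal ∣ Ideal.span {(N : NumberField.RingOfIntegers ℚ)}) ∧ (∀ α, crit α → ∃ π : Literature.NumberTheory.Automorphic.CuspidalAutomorphicRepData n ℚ (hc n), π.1.HasInfinityType w ∧ ∀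 v, π.1.HasSatakeParamAt v (α v) ∨ v ∈ S) ∧ (∀ (π : Literature.NumberTheory.Automorphic.CuspidalAutomorphicRepData n ℚ (hc n)) α, π.1.HasInfinityType w → (∃ φ ∈ π.1.W, φ ∉ π.1.W' ∧ ∀ u ∈ Literature.NumberTheory.Automorphic.principalCongruenceLevel n ℚ (Ideal.span {(N : NumberField.RingOfIntegers ℚ)}), Literature.NumberTheory.Automorphic.rightTranslation (Literature.NumberTheory.Automorphic.AdelicGroupData.gl n ℚ) u φ = φ) → (∀ v, π.1.HasSatakeParamAt v (α v) ∨ v ∈ S) → crit α)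

/-- item stmt-Langlands-3699 · crux · rank 4 · closed · moot by None · by planner
why it might fail: ρ is ONE ℓ-adic rep, any ℓ, automorphic over an arbitrary Galois F as a black box; a common field needs insoluble base change of τ to F (open; AC Ch.3 Thm 4.2: cyclic prime) or BLGGT 5.5.1+5.4.1 (ρ, ρ_τ odd, polarizable, compatible systems, adequate) — non-self-dual GL_3 τ and non-CM F escape both.
sources: BarnetlambEtAl2014, ArthurClozelAMS120, PatrikisTaylor2014, Qian2022, ACCGHLNSTT2023, HarrisLanTaylorThorneRMS2016
[crux] JOINT POTENTIAL AUTOMORPHY WITH COHOMOLOGICAL TWISTS (card S3), automorphic form: if the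
irreducible ρ (any n) is potentially automorphic as in the target and τ is a cuspidal
regular-algebraic representation of GL_j(𝔸_ℚ), then over a COMMON finite Galois F/ℚ, ρ|_{G_F}
corresponds a.e. to a cuspidal regular-algebraic P of GL_n(𝔸_F) and τ has a weak base change T to F
(automorphic, regular algebraic, Satake(T_u) = Satake(τ_{u∩ℚ})^{f(u|p)} at almost all u). This is
what makes every entry of Φ_ρ an honest critical value: Brauer induction over Gal(F/ℚ) +
Arthur–Clozel along the solvable layers F/F^H gives Λ(s, ρ ⊗ ρ_τ) = ∏ Λ(s, Π_j × T_j)^{n_j},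
meromorphic with functional equation, finite and non-zero at every off-centre critical point (card
S4). Expected proof: lang.S27
(Literature.NumberTheory.Automorphic.exists_galoisRep_of_regularAlgebraic: HLTT/Scholze/Varma) gives
ρ_τ; BarnetlambEtAl2014 Thm 5.4.1 (simultaneous potential automorphy of finitely many compatible
systems, F avoiding any given finite extension) when ρ and ρ_τ are odd, regular, POLARIZABLE and
residually adequate for a density-one set of λ (PatrikisTaylor2014); non-polarizable τ
(non-self-dual classes on GL_3, G -/
@[route_item "route-Langlands-CriticalCocycle"]
def JointPotentialAutomorphy : Prop :=
  ∀ (n j : ℕ) (hQ : Literature.NumberTheory.Automorphic.isCompact_glFiniteIntegralLevel j ℚ) (ℓ : ℕ) [Fact ℓ.Prime] (ι' : PadicAlgCl ℓ ≃+* ℂ) (ρ : Literature.NumberTheory.GaloisRepresentations.FramedGaloisRep ℚ (PadicAlgCl ℓ) n) (τ : Literature.NumberTheory.Automorphic.CuspidalAutomorphicRepData j ℚ hQ), ρ.toGaloisRep.IsIrreducible → τ.1.IsRegularAlgebraic → (∃ (F : Type) (_ : Field F) (_ : NumberField F) (_ : IsGalois ℚ F) (hF : Literature.NumberTheory.Automorphic.isCompact_glFiniteIntegralLevel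 n F) (P : Literature.NumberTheory.Automorphic.CuspidalAutomorphicRepData n F hF) (W : Literature.NumberTheory.Automorphic.InfinityType F n), P.1.HasInfinityType W ∧ W.IsRegularAlgebraic ∧ (∀ (σ : F →+* ℂ) (p q : Literature.NumberTheory.Automorphic.ArchWeight), p ∈ W σ → q ∈ W σ → p ≠ q → (2 : ℝ) ≤ |(p.a - q.a).re|) ∧ ∀ᶠ w in cofinite, ∃ α, P.1.HasSatakeParamAt w α ∧ (ρ.restrictField F).IsUnramifiedAt w ∧ (ρ.restrictField F).HasFrobCharpolyAt w (Literature.NumberTheory.Automorphic.arithFrobPolyOfSatake ι' w.residueCard n α)) → ∃ (F : Type) (_ : Field F) (_ : NumberField F) (_ : IsGalois ℚ F) (hFn : Literature.NumberTheory.Automorphic.isCompact_glFiniteIntegralLevel n F) (hFm : Literature.NumberTheory.Automorphic.isCompact_glFiniteIntegralLevel j F) (P : Literature.NumberTheory.Automorphic.CuspidalAutomorphicRepData n F hFn) (T : Literature.NumberTheory.Automorphic.AutomorphicRepData (Literature.NumberTheory.Automorphic.AutomorphyDatum.gl j F hFm)), P.1.IsRegularAlgebraic ∧ T.IsRegularAlgebraic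 ∧ (∀ᶠ u in cofinite, ∃ α, P.1.HasSatakeParamAt u α ∧ (ρ.restrictField F).IsUnramifiedAt u ∧ (ρ.restrictField F).HasFrobCharpolyAt u (Literature.NumberTheory.Automorphic.arithFrobPolyOfSatake ι' u.residueCard n α)) ∧ (∀ᶠ u in cofinite, ∃ γ, T.HasSatakeParamAt u γ ∧ ∃ δ, τ.1.HasSatakeParamAt (u.under (NumberField.RingOfIntegers ℚ)) δ ∧ γ = δ.map fun b => b ^ u.asIdeal.inertiaDeg (NumberField.RingOfIntegers ℚ))

/-- item stmt-Langlands-3698 · support · rank 3 · closed · moot by None · by planner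
why it might fail: Cannot fail as typed: choose (N,w) carrying a genuine cusp form (Sym^(n−1)Δ, level 1); by zero-padding no finite presentation there has Converse ∧ Necessity, so the ∀-presentation clause is vacuous. Content returns only after #3697 is restated.
sources: KazhdanMazurSchmidt2000, BarnetlambEtAl2014, Literature.NumberTheory.Automorphic.NewtonThorne2021_exists_cuspidal_symmPowerLift, Literature.NumberTheory.Automorphic.Gelbart1975_exists_adelicNewform
[crux] THE COCYCLE IDENTITY ('the off-centre critical values of ρ form a cocycle') — interim typed
SHADOW. For every irreducible potentially automorphic ρ as in the target (n ≥ 2) there are a level N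
≥ 1 (intended: conductor of ρ times a power of ℓ) and a regular-algebraic w with HT gaps ≥ 2
(intended: its Hodge–Tate type) such that for EVERY presentation of (n, N, w) with Converse ∧
Necessity as in CohomologicalConverse, and granted joint potential automorphy of ρ with every piece
τ_k (so that the Euler limits ARE the off-centre critical values of the meromorphic Λ(ρ ⊗ ρ_{τ_k}) —
card S4: absolutely convergent product, Jacquet–Shalika non-vanishing on the boundary line, FE
mirrors), the Frobenius data of ρ off S give a candidate α with crit(α). LOGICAL STATUS, stated
openly: given Necessity, crit(α_ρ) ⟺ ρ automorphic, so this decl is equivalent to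
(CohomologicalConverse → PotentialAutomorphyDescends). It is a CRUX because it is where (B) lives in
this route and because its intended form is not a restatement: once defn
RelativeModularSymbolPresentation lands it will be RESTATED (route edit --restate) as 'Φ_ρ kills the
KMS relation module' — explicit identities among unconditional n -/
@[route_item "route-Langlands-CriticalCocycle"]
def CocycleIdentity : Prop :=
  ∀ (n ℓ : ℕ) [Fact ℓ.Prime] (ι' : PadicAlgCl ℓ ≃+* ℂ) (ρ : Literature.NumberTheory.GaloisRepresentations.FramedGaloisRep ℚ (PadicAlgCl ℓ) n), 2 ≤ n → ρ.toGaloisRep.IsIrreducible → (∃ (F : Type) (_ : Field F) (_ : NumberField F) (_ : IsGalois ℚ F) (hF : Literature.NumberTheory.Automorphic.isCompact_glFiniteIntegralLevel n F) (P : Literature.NumberTheory.Automorphic.CuspidalAutomorphicRepData n F hF) (W : Literature.NumberTheory.Automorphic.InfinityType F n), P.1.HasInfinityType W ∧ W.IsRegularAlgebraic ∧ (∀ (σ : F →+* ℂ) (p q : Literature.NumberTheory.Automorphic.ArchWeight), p ∈ W σ → q ∈ W σ → p ≠ q → (2 : ℝ) ≤ |(p.a - q.a).re|) ∧ ∀ᶠ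 w in cofinite, ∃ α, P.1.HasSatakeParamAt w α ∧ (ρ.restrictField F).IsUnramifiedAt w ∧ (ρ.restrictField F).HasFrobCharpolyAt w (Literature.NumberTheory.Automorphic.arithFrobPolyOfSatake ι' w.residueCard n α)) → ∃ (N : ℕ) (w : Literature.NumberTheory.Automorphic.InfinityType ℚ n), 1 ≤ N ∧ w.IsRegularAlgebraic ∧ (∀ (σ : ℚ →+* ℂ) (p q : Literature.NumberTheory.Automorphic.ArchWeight), p ∈ w σ → q ∈ w σ → p ≠ q → (2 : ℝ) ≤ |(p.a - q.a).re|) ∧ ∀ (hc : ∀ j : ℕ, Literature.NumberTheory.Automorphic.isCompact_glFiniteIntegralLevel j ℚ) (ι κ : Type) (_ : Fintype ι) (_ : Fintype κ) (own : κ → ι) (m : κ → ℕ) (τ : ∀ k, Literature.NumberTheory.Automorphic.CuspidalAutomorphicRepData (m k) ℚ (hc (m k))) (β : κ → IsDedekindDomain.HeightOneSpectrum (NumberField.RingOfIntegers ℚ) → Multiset ℂ) (s : κ → ℂ) (dual : κ → Bool) (d : ℕ) (R : Set (ι → MvPolynomial (Fin d) ℂ)) (S : Finset (IsDedekindDomain.HeightOneSpectrum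 (NumberField.RingOfIntegers ℚ))), let crit : (IsDedekindDomain.HeightOneSpectrum (NumberField.RingOfIntegers ℚ) → Multiset ℂ) → Prop := fun α => ∃ (x : Fin d → ℂ) (z : κ → ℂ), (∀ k, Tendsto (fun X : ℕ => ∏ᶠ v ∈ {v : IsDedekindDomain.HeightOneSpectrum (NumberField.RingOfIntegers ℚ) | v ∉ S ∧ v.residueCard ≤ X}, ((if dual k then (α v).map (fun a => a⁻¹) else α v).bind fun a => (β k v).map fun b => (1 - a * b * (v.residueCard : ℂ) ^ (-(s k)))⁻¹).prod) atTop (𝓝 (z k))) ∧ ∀ r ∈ R, ∑ i, MvPolynomial.eval x (r i) * (∏ k ∈ Finset.univ.filter (fun k => own k = i), z k) = 0; ((∀ k, m k < n ∧ (τ k).1.IsRegularAlgebraic ∧ ∀ v, (τ k).1.HasSatakeParamAt v (β k v) ∨ v ∈ S) ∧ (∀ v, v ∈ S ∨ ¬ v.asIdeal ∣ Ideal.span {(N : NumberField.RingOfIntegers ℚ)}) ∧ (∀ α, crit α → ∃ π : Literature.NumberTheory.Automorphic.CuspidalAutomorphicRepData n ℚ (hc n), π.1.HasInfinityType w ∧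 ∀ v, π.1.HasSatakeParamAt v (α v) ∨ v ∈ S) ∧ (∀ (π : Literature.NumberTheory.Automorphic.CuspidalAutomorphicRepData n ℚ (hc n)) α, π.1.HasInfinityType w → (∃ φ ∈ π.1.W, φ ∉ π.1.W' ∧ ∀ u ∈ Literature.NumberTheory.Automorphic.principalCongruenceLevel n ℚ (Ideal.span {(N : NumberField.RingOfIntegers ℚ)}), Literature.NumberTheory.Automorphic.rightTranslation (Literature.NumberTheory.Automorphic.AdelicGroupData.gl n ℚ) u φ = φ) → (∀ v, π.1.HasSatakeParamAt v (α v) ∨ v ∈ S) → crit α)) → (∀ k, ∃ (F : Type) (_ : Field F) (_ : NumberField F) (_ : IsGalois ℚ F) (hFn : Literature.NumberTheory.Automorphic.isCompact_glFiniteIntegralLevel n F) (hFm : Literature.NumberTheory.Automorphic.isCompact_glFiniteIntegralLevel (m k) F) (P : Literature.NumberTheory.Automorphic.CuspidalAutomorphicRepData n F hFn) (T : Literature.NumberTheory.Automorphic.AutomorphicRepData (Literature.NumberTheory.Automorphic.AutomorphyDatum.gl (m k) F hFm)), P.1.IsRegularAlgebraic ∧ T.IsRegularAlgebraic ∧ (∀ᶠ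 u in cofinite, ∃ α, P.1.HasSatakeParamAt u α ∧ (ρ.restrictField F).IsUnramifiedAt u ∧ (ρ.restrictField F).HasFrobCharpolyAt u (Literature.NumberTheory.Automorphic.arithFrobPolyOfSatake ι' u.residueCard n α)) ∧ (∀ᶠ u in cofinite, ∃ γ, T.HasSatakeParamAt u γ ∧ ∃ δ, (τ k).1.HasSatakeParamAt (u.under (NumberField.RingOfIntegers ℚ)) δ ∧ γ = δ.map fun b => b ^ u.asIdeal.inertiaDeg (NumberField.RingOfIntegers ℚ))) → ∃ α, (∀ v, (ρ.IsUnramifiedAt v ∧ ρ.HasFrobCharpolyAt v (Literature.NumberTheory.Automorphic.arithFrobPolyOfSatake ι' v.residueCard n (α v))) ∨ v ∈ S) ∧ crit α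

/-- item stmt-Langlands-3700 · support · rank 9 · closed · moot by None · by planner
why it might fail: As typed F is any solvable Galois field: at each cyclic prime layer E/E′ the descended π′ is fixed only up to η^i and matching ρ|E′ at INERT places needs r(π′), i.e. HLTT over totally real/CM E′; for mixed-signature layers (e.g. complex A₄-fields) no tool exists.
sources: ArthurClozelAMS120, HarrisLanTaylorThorneRMS2016, BarnetlambEtAl2014, Literature.NumberTheory.Automorphic.cuspidal_descent_cyclic, Literature.NumberTheory.Automorphic.exists_galoisRep_of_regularAlgebraic, book:arthur1989-simple-algebras-base-change-advanced-theory-trace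
[support] The target when Gal(F/ℚ) is SOLVABLE: descend Π along a composition series of cyclic
layers (Arthur–Clozel Ch. 3 Thm 6.2, Lemma 6.4: a Galois-invariant cuspidal Π_E on a cyclic prime
layer E/E' descends, uniquely up to twist by characters of Gal(E/E'); the twist is pinned by
comparing Frobenius traces with ρ|_{E'}, Chebotarev). Tree:
Literature.NumberTheory.Automorphic.ArthurClozelCuspidalDescent* / cuspidal_descent_cyclic (named
facts). Provable from named facts; calibrates the frame and isolates the insoluble layer as the
whole difficulty. Subtlety for the prover: irreducibility of ρ|_{E'} at each step (needed for
uniqueness of the twist) — if it fails, Π_E is not cuspidal-compatible; state the lemma with ρ|_F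
irreducible if necessary (then restate). -/
@[route_item "route-Langlands-CriticalCocycle"]
def SolvableDescent : Prop :=
  ∀ (n ℓ : ℕ) [Fact ℓ.Prime] (ι' : PadicAlgCl ℓ ≃+* ℂ) (hQ : Literature.NumberTheory.Automorphic.isCompact_glFiniteIntegralLevel n ℚ) (ρ : Literature.NumberTheory.GaloisRepresentations.FramedGaloisRep ℚ (PadicAlgCl ℓ) n), 2 ≤ n → ρ.toGaloisRep.IsIrreducible → (∃ (F : Type) (_ : Field F) (_ : NumberField F) (_ : IsGalois ℚ F) (_ : IsSolvable (F ≃ₐ[ℚ] F)) (hF : Literature.NumberTheory.Automorphic.isCompact_glFiniteIntegralLevel n F) (P : Literature.NumberTheory.Automorphic.CuspidalAutomorphicRepData n F hF) (W : Literature.NumberTheory.Automorphic.InfinityType F n), P.1.HasInfinityType W ∧ W.IsRegularAlgebraic ∧ (∀ (σ : F →+* ℂ) (p q : Literature.NumberTheory.Automorphic.ArchWeight), p ∈ W σ → q ∈ W σ → p ≠ q → (2 : ℝ) ≤ |(p.a - q.a).re|) ∧ ∀ᶠ w in cofinite, ∃ α, P.1.HasSatakeParamAt w α ∧ (ρ.restrictField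 F).IsUnramifiedAt w ∧ (ρ.restrictField F).HasFrobCharpolyAt w (Literature.NumberTheory.Automorphic.arithFrobPolyOfSatake ι' w.residueCard n α)) → ∃ π : Literature.NumberTheory.Automorphic.CuspidalAutomorphicRepData n ℚ hQ, π.1.IsRegularAlgebraic ∧ ∀ᶠ v in cofinite, ∃ α, π.1.HasSatakeParamAt v α ∧ ρ.IsUnramifiedAt v ∧ ρ.HasFrobCharpolyAt v (Literature.NumberTheory.Automorphic.arithFrobPolyOfSatake ι' v.residueCard n α)

/-- item stmt-Langlands-3701 · support · rank 9 · closed · moot by None · by planner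
why it might fail: FALSE as typed by the same zero-padding as #3697 (n = 2, Δ at N = 1): planner-folder Sketch.lean not_cohomologicalConverseRankTwo : ExistsGenuineCuspForm 2 → ¬CohomologicalConverseRankTwo, lean check rc 0.
sources: Razar1977, PasolPopa2013, Merel1994, Manin1973, Literature.NumberTheory.Automorphic.Gelbart1975_exists_adelicNewform, Literature.NumberTheory.Automorphic.AutomorphicRepData.HasSatakeParamAt.card_eq
[support] n = 2 instance of CohomologicalConverse (pieces = GL_1 cuspidal data = Hecke characters of
ℚ; presentation = Manin symbols of level Γ(N) with the half of the period polynomial of parity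
opposite to the central index: Kohnen–Zagier r⁻ : S_k ≅ W⁻ and r⁺ onto W⁺ modulo the Eisenstein
line; level N: PasolPopa2013; converse direction = Eichler–Shimura–Manin read backwards, Razar1977;
Hecke action on symbols: Merel1994, Manin1973; Necessity = Eichler–Shimura + Mellin; for k even ≥ 4
every probe is absolutely convergent or an FE-mirror, for k odd ≥ 3 the two near-central probes sit
ON the boundary line and are conditionally convergent ordered Euler products (PNT for GL_2 × GL_1)).
Provable now in principle (all ingredients classical); needs weight-k modular symbols / period
polynomials for Γ_1(N) or Γ(N) — the tree has weight 2 only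
(Literature.NumberTheory.EllipticCurves.ModularSymbols*) and the classical dictionary CuspForm ↔
CuspidalAutomorphicRepData 2 ℚ (Gelbart1975_exists_adelicNewform,
Literature.NumberTheory.Automorphic.Sweep1SymmetricPowerAdelic). A proof here is the calibration of
crux #2. -/
@[route_item "route-Langlands-CriticalCocycle"]
def CohomologicalConverseRankTwo : Prop :=
  ∀ (N : ℕ), 1 ≤ N → ∀ (hc : ∀ j : ℕ, Literature.NumberTheory.Automorphic.isCompact_glFiniteIntegralLevel j ℚ) (w : Literature.NumberTheory.Automorphic.InfinityType ℚ 2), w.IsRegularAlgebraic → (∀ (σ : ℚ →+* ℂ) (p q : Literature.NumberTheory.Automorphic.ArchWeight), p ∈ w σ → q ∈ w σ → p ≠ q → (2 : ℝ) ≤ |(p.a - q.a).re|) → ∃ (ι κ : Type) (_ : Fintype ι) (_ : Fintype κ) (own : κ → ι) (m : κ → ℕ) (τ : ∀ k, Literature.NumberTheory.Automorphic.CuspidalAutomorphicRepData (m k) ℚ (hc (m k))) (β : κ → IsDedekindDomain.HeightOneSpectrum (NumberField.RingOfIntegers ℚ) → Multiset ℂ) (s : κ → ℂ) (dual : κ →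 Bool) (d : ℕ) (R : Set (ι → MvPolynomial (Fin d) ℂ)) (S : Finset (IsDedekindDomain.HeightOneSpectrum (NumberField.RingOfIntegers ℚ))), let crit : (IsDedekindDomain.HeightOneSpectrum (NumberField.RingOfIntegers ℚ) → Multiset ℂ) → Prop := fun α => ∃ (x : Fin d → ℂ) (z : κ → ℂ), (∀ k, Tendsto (fun X : ℕ => ∏ᶠ v ∈ {v : IsDedekindDomain.HeightOneSpectrum (NumberField.RingOfIntegers ℚ) | v ∉ S ∧ v.residueCard ≤ X}, ((if dual k then (α v).map (fun a => a⁻¹) else α v).bind fun a => (β k v).map fun b => (1 - a * b * (v.residueCard : ℂ) ^ (-(s k)))⁻¹).prod) atTop (𝓝 (z k))) ∧ ∀ r ∈ R, ∑ i, MvPolynomial.eval x (r i) * (∏ k ∈ Finset.univ.filter (fun k => own k = i), z k) = 0; (∀ k, m k < 2 ∧ (τ k).1.IsRegularAlgebraic ∧ ∀ v, (τ k).1.HasSatakeParamAt v (β k v) ∨ v ∈ S) ∧ (∀ v, v ∈ S ∨ ¬ v.asIdeal ∣ Ideal.span {(N : NumberField.RingOfIntegers ℚ)}) ∧ (∀ α,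 crit α → ∃ π : Literature.NumberTheory.Automorphic.CuspidalAutomorphicRepData 2 ℚ (hc 2), π.1.HasInfinityType w ∧ ∀ v, π.1.HasSatakeParamAt v (α v) ∨ v ∈ S) ∧ (∀ (π : Literature.NumberTheory.Automorphic.CuspidalAutomorphicRepData 2 ℚ (hc 2)) α, π.1.HasInfinityType w → (∃ φ ∈ π.1.W, φ ∉ π.1.W' ∧ ∀ u ∈ Literature.NumberTheory.Automorphic.principalCongruenceLevel 2 ℚ (Ideal.span {(N : NumberField.RingOfIntegers ℚ)}), Literature.NumberTheory.Automorphic.rightTranslation (Literature.NumberTheory.Automorphic.AdelicGroupData.gl 2 ℚ) u φ = φ) → (∀ v, π.1.HasSatakeParamAt v (α v) ∨ v ∈ S) → crit α)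

/-- item stmt-Langlands-3702 · support · rank 9 · closed · moot by None · by planner
why it might fail: Open in general: automorphic induction of Hecke characters through K/ℚ with insoluble Galois closure contains monomial strong-Artin cases (finite-order ω, even A₅/S₅-type constituents); known only inside solvable Galois extensions (AC), non-normal cubic (JPSS), odd icosahedral quintics (Kim 2004).
sources: ArthurClozelAMS120, Kim2004, JPSS1981Cubique, Literature.NumberTheory.Automorphic.automorphicInduction_character, Literature.Barriers.Langlands.SolvableImageBarrierNarrow
[support] FIRST OPEN INSTANCES (card: 'the natural home' of the mechanism): automorphic induction of
an ALGEBRAIC Hecke character ω of an arbitrary number field K of degree n through the possibly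
NON-NORMAL extension K/ℚ — an automorphic π of GL_n(𝔸_ℚ) with det(X − t_{π,p}) = ∏_{w|p} (X^{f(w|p)}
− ω(ϖ_w)) at almost all p (template:
Literature.NumberTheory.Automorphic.automorphicInduction_character, which is the cyclic prime-degree
case, Arthur–Clozel Thm 6.2). Open when the Galois closure of K is insoluble (e.g. K CM of degree 10
whose quintic subfield has A_5-closure, ω of regular infinity type: ρ = Ind ω_λ is irreducible,
regular, polarizable, totally odd, hence potentially automorphic by BLGGT — an instance of the
target). Stated for all algebraic ω (the type-A₀ predicate HeckeCharacter.IsAlgebraic does not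
expose regularity); the mechanism of this route reaches the regular CM ones, the finite-order
(Artin) ones belong to the Artin-sector cards. π is asserted automorphic, not cuspidal (cuspidality
⟺ Ind irreducible). -/
@[route_item "route-Langlands-CriticalCocycle"]
def NonNormalInduction : Prop :=
  ∀ (K : Type) [Field K] [NumberField K] (ω : Literature.NumberTheory.GaloisRepresentations.HeckeCharacter K), ω.IsAlgebraic → ∀ (hQ : Literature.NumberTheory.Automorphic.isCompact_glFiniteIntegralLevel (Module.finrank ℚ K) ℚ), ∃ π : Literature.NumberTheory.Automorphic.AutomorphicRepData (Literature.NumberTheory.Automorphic.AutomorphyDatum.gl (Module.finrank ℚ K) ℚ hQ), ∀ᶠ v in cofinite, ∃ α, π.HasSatakeParamAt v α ∧ Literature.NumberTheory.Automorphic.satakePolynomial α = ∏ᶠ w ∈ {w : IsDedekindDomain.HeightOneSpectrum (NumberField.RingOfIntegers K) | w.under (NumberField.RingOfIntegers ℚ) = v}, (Polynomial.X ^ w.asIdeal.inertiaDeg (NumberField.RingOfIntegers ℚ) - Polynomial.C (ω.valueAtUniformizer w))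

/-- item stmt-Langlands-3703 · assembly · rank 1 · closed · moot by None · by planner
[assembly] Elementary: given ρ as in the target, CocycleIdentity yields (N, w) with w
regular-algebraic of HT gaps ≥ 2; CohomologicalConverse (n, N, w, hc := fun j =>
isCompact_glFiniteIntegralLevel_holds) yields a presentation with Converse ∧ Necessity;
JointPotentialAutomorphy applied to each piece τ_k discharges the joint hypothesis; CocycleIdentity
then gives α (= Frobenius data of ρ off S) with crit(α); Converse gives a cuspidal π with infinity
type w (hence IsRegularAlgebraic) and Satake α off S; S finite ⇒ the cofinite matching of the target
(proof irrelevance identifies hc n with hQ). Provable now; no named fact is consumed (S27/BLGGT live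
inside the cruxes). -/
@[route_item "route-Langlands-CriticalCocycle"]
def Assembly : Prop :=
  CohomologicalConverse → JointPotentialAutomorphy → CocycleIdentity → PotentialAutomorphyDescends

end Summit.Langlands.Langlands.Theses.CriticalCocycle
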